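import Summits.CriticalPhenomena.CardyFormulaZ2.Theorems.CardyWhiteToColouredSimilarityUpgradeStubSymmetricHalfFull

/-!
# Full limits are invariant under real-positive affine maps, unconditionally
# (crux `SimilarityUpgrade`, stmt-CriticalPhenomena-4597, line `registered`, lead c5: stub `stub_fullLimitRealAffine`)

Route `CardyWhiteToColoured`, sub-problem `CardyFormulaZ2`.  The crux
`Summit.CriticalPhenomena.CardyFormulaZ2.Theses.CardyWhiteToColoured.SimilarityUpgrade` carries two
hypotheses on the limit functional `Φ : ConformalRectangle → ℝ`: (i) FULL limits
`bondDomainCrossingProb R δ → Φ R` as `δ → 0⁺` for every conformal rectangle `R`, and (ii) invariance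
of `Φ` under every similarity `z ↦ a z + w`, `a ∈ ℂ*`.  Lead c3 showed (i) ⇒ (ii) MODULO the vendored
DKKMO rotation invariance (`Theorems.SimilarityUpgradeReduction.simInvariant_of_fullLimit`).  This
file records the UNCONDITIONAL part of that implication: for REAL POSITIVE `a` (a dilation followed by
a translation — no rotation) a full limit is invariant with no named fact at all
(`stub_fullLimitRealAffine`), and more generally for `a = u c`, `c > 0`, `u ∈ {±1, ±i}` (the point
group `D₄` of `ℤ²` is an exact symmetry of the discretisation), both for the holomorphic maps
`z ↦ u c z + w` (`fullLimitRealAffine_latticeSim`) and the antiholomorphic ones `z ↦ u c z̄ + w`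
(`fullLimitRealAffine_latticeAntiSim`): full limits are invariant under the whole group generated by
translations, positive dilations and `D₄`, unconditionally.  What is NOT here: rotations by angles
other than multiples of `π/2` (that is DKKMO Cor. 1.3, a named fact, see c3's file).

Proof.  A full limit is the joint sequential limit along the meshes `1/(n+1)`
(`symmetricHalfFull_jointLimit`).  The dilation by `c > 0` intertwines the meshes `1/(n+1)` and
`1/((n+1)c)`, along both of which `Φ` is the limit (`JointLimit.tendsto_dilate`,
`JointLimit.tendsto_div_const`, exact scale covariance of the discretisation), so
`Φ (c·R) = Φ R` (`fullLimitRealAffine_map_dilate`); translations are `JointLimit.map_addLeft`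
(Schramm–Smirnov perturbation theory, proved in the tree; full-limit form
`symmetricHalfFull_map_addLeft` of lead c4); quarter turns and the conjugation are c4's
`symmetricHalfFull_exists_homeomorph`.  Composites are handled by functoriality of
`MarkedDomain.map` (`MarkedDomain.map_map`), and the passage from "`R'` has the carrier and arcs
`0`, `2` of `T(R)`" to `Φ R' = Φ (T R)` is the remark that `bondDomainCrossingProb` depends only on
the carrier and the arcs `0`, `2` (`fullLimitRealAffine_eq_of_map`).  No definitions are introduced.

References: O. Schramm, S. Smirnov, *On the scaling limits of planar percolation*, Ann. Probab. 39
(2011) §1.3, §5, Lemma 5.1; S. Smirnov, C. R. Acad. Sci. Paris 333 (2001) §2; H. Duminil-Copin,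
K. K. Kozlowski, D. Krachun, I. Manolescu, M. Oulamara, arXiv:2012.11672, Cor. 1.3 (NOT used here).
-/

noncomputable section

namespace Summit.CriticalPhenomena.CardyFormulaZ2.Cruxes.SimilarityUpgrade.Stubs

open Filter Topology Set MeasureTheory
open Literature.Probability.RandomPlanarGeometry
open Literature.Probability.Percolation
open Summit.CriticalPhenomena.CardyFormulaZ2.Cruxes.SubseqCardy.Birth

/-! ### Transport along an invariant plane homeomorphism -/

/-- If the full limit `Φ` is invariant under the plane homeomorphism `T` (`Φ (T S) = Φ S` for all
`S`) and the conformal rectangle `R'` has the carrier and the arcs `0`, `2` of `T(R)`, then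
`Φ R' = Φ R`: the crossing probability `bondDomainCrossingProb` depends only on the carrier and the
arcs `0`, `2`, so `R'` and `T(R)` have the same crossing probabilities mesh by mesh, hence the same
full limit. [folklore] -/
theorem fullLimitRealAffine_eq_of_map {Φ : ConformalRectangle → ℝ}
    (hΦ : ∀ R : ConformalRectangle, Tendsto (bondDomainCrossingProb R) (𝓝[>] (0 : ℝ)) (𝓝 (Φ R)))
    (T : ℂ ≃ₜ ℂ) (hT : ∀ S : ConformalRectangle, Φ (S.map T) = Φ S) (R R' : ConformalRectangle)
    (hcar : R'.carrier = T '' R.carrier) (h0 : R'.arc 0 = T '' R.arc 0)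
    (h2 : R'.arc 2 = T '' R.arc 2) : Φ R' = Φ R := by
  -- the crossing probabilities of `R'` are those of `T(R)`, mesh by mesh
  have hP : bondDomainCrossingProb R' = bondDomainCrossingProb (R.map T) := by
    funext δ
    rw [bondDomainCrossingProb_eq_measureReal, bondDomainCrossingProb_eq_measureReal, hcar, h0, h2,
      MarkedDomain.carrier_map, MarkedDomain.arc_map, MarkedDomain.arc_map]
  have e1 : Φ R' = Φ (R.map T) := by
    refine tendsto_nhds_unique (hΦ R') ?_
    rw [hP]
    exact hΦ _
  rw [e1, hT R]

/-! ### Positive dilations -/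

/-- **Full limits are invariant under positive dilations** (unconditionally): if
`bondDomainCrossingProb R δ → Φ R` as `δ → 0⁺` for every `R`, then `Φ (c·R) = Φ R` for every `c > 0`.
The dilation intertwines the mesh sequences `1/(n+1)` and `1/((n+1)c)` (exact scale covariance of
the discretisation, `JointLimit.tendsto_dilate`), and a FULL limit is the limit along both. (For a
mere joint SEQUENTIAL limit this is exactly the open dilation covariance.) [folklore] -/
theorem fullLimitRealAffine_map_dilate {Φ : ConformalRectangle → ℝ}
    (hΦ : ∀ R : ConformalRectangle, Tendsto (bondDomainCrossingProb R) (𝓝[>] (0 : ℝ)) (𝓝 (Φ R)))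
    {c : ℝ} (hc : 0 < c) (T : ℂ ≃ₜ ℂ) (hT : ∀ z, T z = (c : ℂ) * z) (R : ConformalRectangle) :
    Φ (R.map T) = Φ R :=
  have hu : Tendsto (fun n : ℕ => 1 / ((n : ℝ) + 1)) atTop (𝓝[>] (0 : ℝ)) :=
    tendsto_nhdsWithin_iff.2 ⟨tendsto_one_div_add_atTop_nhds_zero_nat,
      Eventually.of_forall fun n => mem_Ioi.2 (by positivity)⟩
  tendsto_nhds_unique (JointLimit.tendsto_dilate (symmetricHalfFull_jointLimit hΦ) hc T hT R)
    ((hΦ R).comp (JointLimit.tendsto_div_const hu hc))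

/-- The real-positive affine map `z ↦ a z + w` (`a > 0`, `w ∈ ℂ`) is realised by a plane
homeomorphism leaving every full limit invariant: the dilation by `a` followed by the translation by
`w` (`fullLimitRealAffine_map_dilate`, and Schramm–Smirnov translation invariance
`symmetricHalfFull_map_addLeft` / `JointLimit.map_addLeft`). [folklore] -/
theorem fullLimitRealAffine_exists_homeomorph {Φ : ConformalRectangle → ℝ}
    (hΦ : ∀ R : ConformalRectangle, Tendsto (bondDomainCrossingProb R) (𝓝[>] (0 : ℝ)) (𝓝 (Φ R)))
    {a : ℝ} (ha : 0 < a) (w : ℂ) :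
    ∃ T : ℂ ≃ₜ ℂ, (∀ z, T z = (a : ℂ) * z + w) ∧ ∀ R : ConformalRectangle, Φ (R.map T) = Φ R := by
  have ha' : (a : ℂ) ≠ 0 := Complex.ofReal_ne_zero.2 ha.ne'
  have hMz : ∀ z : ℂ, Homeomorph.mulLeft₀ (a : ℂ) ha' z = (a : ℂ) * z := fun _ => rfl
  have hVz : ∀ z : ℂ, Homeomorph.addLeft w z = w + z := fun _ => rfl
  refine ⟨(Homeomorph.mulLeft₀ (a : ℂ) ha').trans (Homeomorph.addLeft w), fun z => ?_, fun R => ?_⟩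
  · rw [Homeomorph.trans_apply, hVz, hMz, add_comm]
  · rw [← MarkedDomain.map_map, symmetricHalfFull_map_addLeft hΦ,
      fullLimitRealAffine_map_dilate hΦ ha (Homeomorph.mulLeft₀ (a : ℂ) ha') hMz]

/-! ### The registered stub -/

/-- **stub_fullLimitRealAffine — full limits are invariant under real-positive affine maps,
unconditionally.** If `bondDomainCrossingProb R δ → Φ R` as `δ → 0⁺` for EVERY conformal rectangle
`R`, then `Φ R' = Φ R` whenever the carrier and the arcs `0`, `2` of `R'` are the images of those of
`R` under `z ↦ a z + w` with `a > 0` real and `w ∈ ℂ`.  Proof: `Φ` is the joint sequential limit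
along `1/(n+1)`; the dilation by `a` intertwines the meshes `1/(n+1)` and `1/((n+1)a)`, along both of
which `Φ` is the limit (`JointLimit.tendsto_dilate`); the translation by `w` is Schramm–Smirnov's
perturbation lemma (`JointLimit.map_addLeft`, proved); and the crossing probability of `R'` depends
only on its carrier and arcs `0`, `2`.  This is c3's `simInvariant_of_fullLimit` with the rotation
step (DKKMO Cor. 1.3) deleted: no named fact is used. [cite: SchrammSmirnov2011, Lemma 5.1] -/
theorem stub_fullLimitRealAffine : ∀ Φ : ConformalRectangle → ℝ, (∀ R : ConformalRectangle, Tendsto (bondDomainCrossingProb R) (𝓝[>] (0 : ℝ)) (𝓝 (Φ R))) → ∀ (R R' : ConformalRectangle) (a : ℝ) (w : ℂ), 0 < a → R'.carrier = (fun z : ℂ => (a : ℂ) * z + w) '' R.carrier → R'.arc 0 = (fun z : ℂ => (a : ℂ) * z + w) '' R.arc 0 → R'.arc 2 = (fun z : ℂ => (a : ℂ) * z + w) '' R.arc 2 → Φ R' = Φ R := by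
  intro Φ hΦ R R' a w ha hcar h0 h2
  obtain ⟨T, hT, hinv⟩ := fullLimitRealAffine_exists_homeomorph hΦ ha w
  have himg : ∀ X : Set ℂ, (fun z : ℂ => (a : ℂ) * z + w) '' X = T '' X :=
    fun X => image_congr fun z _ => (hT z).symm
  rw [himg] at hcar h0 h2
  exact fullLimitRealAffine_eq_of_map hΦ T hinv R R' hcar h0 h2

/-! ### The lattice similarity group: translations, positive dilations and `D₄` -/

/-- For `u ∈ {±1, ±i}`, `c > 0` and `w ∈ ℂ` the similarity `z ↦ u c z + w` is realised by a plane
homeomorphism leaving every full limit invariant: conjugation, then the dilation by `c`, then c4's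
homeomorphism realising the affine reflection `z ↦ u z̄ + w` (`symmetricHalfFull_exists_homeomorph`;
the two conjugations cancel). [folklore] -/
theorem fullLimitRealAffine_exists_homeomorph_latticeSim {Φ : ConformalRectangle → ℝ}
    (hΦ : ∀ R : ConformalRectangle, Tendsto (bondDomainCrossingProb R) (𝓝[>] (0 : ℝ)) (𝓝 (Φ R)))
    (u w : ℂ) (hu : u = 1 ∨ u = -1 ∨ u = Complex.I ∨ u = -Complex.I) {c : ℝ} (hc : 0 < c) :
    ∃ T : ℂ ≃ₜ ℂ, (∀ z, T z = u * (c : ℂ) * z + w) ∧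
      ∀ R : ConformalRectangle, Φ (R.map T) = Φ R := by
  obtain ⟨S, hS, hinv⟩ := symmetricHalfFull_exists_homeomorph hΦ u w hu
  have hc' : (c : ℂ) ≠ 0 := Complex.ofReal_ne_zero.2 hc.ne'
  have hMz : ∀ z : ℂ, Homeomorph.mulLeft₀ (c : ℂ) hc' z = (c : ℂ) * z := fun _ => rfl
  have hCz : ∀ z : ℂ, Complex.conjCLE.toHomeomorph z = (starRingEnd ℂ) z := fun _ => rfl
  refine ⟨(Complex.conjCLE.toHomeomorph.trans (Homeomorph.mulLeft₀ (c : ℂ) hc')).trans S,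
    fun z => ?_, fun R => ?_⟩
  · rw [Homeomorph.trans_apply, Homeomorph.trans_apply, hS, hMz, hCz, map_mul, Complex.conj_ofReal,
      Complex.conj_conj, mul_assoc]
  · rw [← MarkedDomain.map_map, ← MarkedDomain.map_map, hinv,
      fullLimitRealAffine_map_dilate hΦ hc (Homeomorph.mulLeft₀ (c : ℂ) hc') hMz,
      symmetricHalfFull_map_conj hΦ]

/-- For `u ∈ {±1, ±i}`, `c > 0` and `w ∈ ℂ` the anti-similarity `z ↦ u c z̄ + w` is realised by a
plane homeomorphism leaving every full limit invariant: the dilation by `c`, then c4's homeomorphism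
realising `z ↦ u z̄ + w` (`symmetricHalfFull_exists_homeomorph`). [folklore] -/
theorem fullLimitRealAffine_exists_homeomorph_latticeAntiSim {Φ : ConformalRectangle → ℝ}
    (hΦ : ∀ R : ConformalRectangle, Tendsto (bondDomainCrossingProb R) (𝓝[>] (0 : ℝ)) (𝓝 (Φ R)))
    (u w : ℂ) (hu : u = 1 ∨ u = -1 ∨ u = Complex.I ∨ u = -Complex.I) {c : ℝ} (hc : 0 < c) :
    ∃ T : ℂ ≃ₜ ℂ, (∀ z, T z = u * (c : ℂ) * (starRingEnd ℂ) z + w) ∧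
      ∀ R : ConformalRectangle, Φ (R.map T) = Φ R := by
  obtain ⟨S, hS, hinv⟩ := symmetricHalfFull_exists_homeomorph hΦ u w hu
  have hc' : (c : ℂ) ≠ 0 := Complex.ofReal_ne_zero.2 hc.ne'
  have hMz : ∀ z : ℂ, Homeomorph.mulLeft₀ (c : ℂ) hc' z = (c : ℂ) * z := fun _ => rfl
  refine ⟨(Homeomorph.mulLeft₀ (c : ℂ) hc').trans S, fun z => ?_, fun R => ?_⟩
  · rw [Homeomorph.trans_apply, hS, hMz, map_mul, Complex.conj_ofReal, mul_assoc]
  · rw [← MarkedDomain.map_map, hinv,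
      fullLimitRealAffine_map_dilate hΦ hc (Homeomorph.mulLeft₀ (c : ℂ) hc') hMz]

/-- **Full limits are invariant under the lattice similarities `z ↦ u c z + w`**
(`u ∈ {±1, ±i}`, `c > 0`, `w ∈ ℂ`), unconditionally: if `bondDomainCrossingProb R δ → Φ R` as
`δ → 0⁺` for every `R`, then `Φ R' = Φ R` whenever the carrier and the arcs `0`, `2` of `R'` are the
images of those of `R` under `z ↦ u c z + w`.  (Translations: Schramm–Smirnov perturbation;
positive dilations: mesh intertwining of full limits; `D₄`: exact lattice symmetry.)  Together with
`fullLimitRealAffine_latticeAntiSim` this is invariance under the whole group generated by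
translations, positive dilations and the point group `D₄` of `ℤ²`; general rotations are DKKMO
Cor. 1.3 and are not claimed. [folklore] -/
theorem fullLimitRealAffine_latticeSim (Φ : ConformalRectangle → ℝ)
    (hΦ : ∀ R : ConformalRectangle, Tendsto (bondDomainCrossingProb R) (𝓝[>] (0 : ℝ)) (𝓝 (Φ R))) :
    ∀ (R R' : ConformalRectangle) (u : ℂ) (c : ℝ) (w : ℂ),
      (u = 1 ∨ u = -1 ∨ u = Complex.I ∨ u = -Complex.I) → 0 < c →
      R'.carrier = (fun z : ℂ => u * (c : ℂ) * z + w) '' R.carrier →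
      R'.arc 0 = (fun z : ℂ => u * (c : ℂ) * z + w) '' R.arc 0 →
      R'.arc 2 = (fun z : ℂ => u * (c : ℂ) * z + w) '' R.arc 2 → Φ R' = Φ R := by
  intro R R' u c w hu hc hcar h0 h2
  obtain ⟨T, hT, hinv⟩ := fullLimitRealAffine_exists_homeomorph_latticeSim hΦ u w hu hc
  have himg : ∀ X : Set ℂ, (fun z : ℂ => u * (c : ℂ) * z + w) '' X = T '' X :=
    fun X => image_congr fun z _ => (hT z).symm
  rw [himg] at hcar h0 h2
  exact fullLimitRealAffine_eq_of_map hΦ T hinv R R' hcar h0 h2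

/-- **Full limits are invariant under the lattice anti-similarities `z ↦ u c z̄ + w`**
(`u ∈ {±1, ±i}`, `c > 0`, `w ∈ ℂ`), unconditionally: if `bondDomainCrossingProb R δ → Φ R` as
`δ → 0⁺` for every `R`, then `Φ R' = Φ R` whenever the carrier and the arcs `0`, `2` of `R'` are the
images of those of `R` under `z ↦ u c z̄ + w` (the crossing of `R'` is still between the images of
the arcs `0` and `2`). [folklore] -/
theorem fullLimitRealAffine_latticeAntiSim (Φ : ConformalRectangle → ℝ)
    (hΦ : ∀ R : ConformalRectangle, Tendsto (bondDomainCrossingProb R) (𝓝[>] (0 : ℝ)) (𝓝 (Φ R))) :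
    ∀ (R R' : ConformalRectangle) (u : ℂ) (c : ℝ) (w : ℂ),
      (u = 1 ∨ u = -1 ∨ u = Complex.I ∨ u = -Complex.I) → 0 < c →
      R'.carrier = (fun z : ℂ => u * (c : ℂ) * (starRingEnd ℂ) z + w) '' R.carrier →
      R'.arc 0 = (fun z : ℂ => u * (c : ℂ) * (starRingEnd ℂ) z + w) '' R.arc 0 →
      R'.arc 2 = (fun z : ℂ => u * (c : ℂ) * (starRingEnd ℂ) z + w) '' R.arc 2 → Φ R' = Φ R := by
  intro R R' u c w hu hc hcar h0 h2
  obtain ⟨T, hT, hinv⟩ := fullLimitRealAffine_exists_homeomorph_latticeAntiSim hΦ u w hu hc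
  have himg : ∀ X : Set ℂ, (fun z : ℂ => u * (c : ℂ) * (starRingEnd ℂ) z + w) '' X = T '' X :=
    fun X => image_congr fun z _ => (hT z).symm
  rw [himg] at hcar h0 h2
  exact fullLimitRealAffine_eq_of_map hΦ T hinv R R' hcar h0 h2

end Summit.CriticalPhenomena.CardyFormulaZ2.Cruxes.SimilarityUpgrade.Stubs

end
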